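import Summits.ABC.ABC.Theorems.CongruentialReceptacleTameLocalReceptacleDefs

/-!
# Crux `TameLocalReceptacle` (stmt-ABC-14354), line `SketchIdeator1`: pinning ⇒ near-residue-free

Registered stub `stub_nearResidueFree_of_pinning` of the checked skeleton
`Cruxes/TameLocalReceptacle/Lines/SketchIdeator1.lean`: under the ternary-smooth residue-pinning
hypothesis EH (`PinningFamilies κ A`, `Theorems/CongruentialReceptacleTameLocalReceptacleDefs.lean`) every
single-table receptacle `t` with `|Φ_t| ≤ c₃` on the `κ`-cell is residue-free up to `2c₃ + c₁'A` on the
data occurring on that cell (`NearResidueFree κ (2c₃ + c₁'A) t`).  One-prime conditioning: the datum at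
`p` is constant on each of the two families, the away-from-`p` means of the window-bounded weight `t/c₁'`
agree within `A` (EH), and exactness pins the two family means of `Φ_t` within `2c₃`.
Proof verbatim from the planner's sketch (planner-cruxidea-stmt-ABC-14354-1-0), kernel-checked there.
-/

-- `Summit.<Summit>.<Problem>` is the mandated summit-side namespace (CONVENTIONS §2); for the
-- single-conjunct summit `ABC` the two coincide, so the duplicate `ABC.ABC` is deliberate.
set_option linter.dupNamespace false

namespace Summit.ABC.ABC.Theorems.TameLocalReceptacle

open Finset Literature.NumberTheory.DiophantineGeometry

/-- PINNING, averaging form: two nonempty finite families on which `|Φ| ≤ c₃` have means within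
`2c₃`. [folklore] -/
theorem pinning_means {ι : Type} (F F' : Finset ι) (hF : F.Nonempty) (hF' : F'.Nonempty)
    (Φ : ι → ℝ) (c₃ : ℝ) (h : ∀ x ∈ F, |Φ x| ≤ c₃) (h' : ∀ x ∈ F', |Φ x| ≤ c₃) :
    |(∑ x ∈ F, Φ x) / F.card - (∑ x ∈ F', Φ x) / F'.card| ≤ 2 * c₃ := by
  have hc : (0 : ℝ) < F.card := by exact_mod_cast hF.card_pos
  have hc' : (0 : ℝ) < F'.card := by exact_mod_cast hF'.card_pos
  have h1 : |(∑ x ∈ F, Φ x) / F.card| ≤ c₃ := by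
    rw [abs_div, abs_of_pos hc, div_le_iff₀ hc]
    calc |∑ x ∈ F, Φ x| ≤ ∑ x ∈ F, |Φ x| := abs_sum_le_sum_abs _ _
      _ ≤ ∑ _x ∈ F, c₃ := sum_le_sum h
      _ = c₃ * F.card := by rw [sum_const, nsmul_eq_mul, mul_comm]
  have h2 : |(∑ x ∈ F', Φ x) / F'.card| ≤ c₃ := by
    rw [abs_div, abs_of_pos hc', div_le_iff₀ hc']
    calc |∑ x ∈ F', Φ x| ≤ ∑ x ∈ F', |Φ x| := abs_sum_le_sum_abs _ _
      _ ≤ ∑ _x ∈ F', c₃ := sum_le_sum h'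
      _ = c₃ * F'.card := by rw [sum_const, nsmul_eq_mul, mul_comm]
  calc |(∑ x ∈ F, Φ x) / F.card - (∑ x ∈ F', Φ x) / F'.card|
      ≤ |(∑ x ∈ F, Φ x) / F.card| + |(∑ x ∈ F', Φ x) / F'.card| := abs_sub _ _
    _ ≤ c₃ + c₃ := add_le_add h1 h2
    _ = 2 * c₃ := by ring

/-- Means are affine. [folklore] -/
theorem mean_affine (F : Finset (ℕ × ℕ × ℕ)) (hF : F.Nonempty) (C m : ℝ) (g : ℕ × ℕ × ℕ → ℝ) :
    mean F (fun T => C + m * g T) = C + m * mean F g := by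
  have hc : (F.card : ℝ) ≠ 0 := by exact_mod_cast hF.card_pos.ne'
  simp only [mean]
  rw [Finset.sum_add_distrib, Finset.sum_const, nsmul_eq_mul, ← Finset.mul_sum]
  field_simp

/-- Splitting the receptacle sum at a prime `p` carrying a prescribed datum. [folklore] -/
theorem recSum_split {c₁' : ℝ} (hc₁' : c₁' ≠ 0) (t : Table) {p a b c i j k r s z : ℕ}
    (hp : p ∈ (a * b * c).primeFactors) (hd : datum a b c p = (i, j, k, r, s, z)) :
    (recSum t a b c : ℝ) = (t p i j k r s z : ℝ) +
      c₁' * recSumAway (fun q i j k r s z => (t q i j k r s z : ℝ) / c₁') p a b c := by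
  simp only [datum, Prod.mk.injEq] at hd
  obtain ⟨h1, h2, h3, h4, h5, h6⟩ := hd
  unfold recSum recSumAway
  rw [← Finset.add_sum_erase _ _ hp]
  push_cast
  rw [h4, h5, h6, h1, h2, h3]
  congr 1
  rw [Finset.mul_sum]
  refine Finset.sum_congr rfl fun q _ => ?_
  simp only [evalAt, datum]
  field_simp

/-- **PINNING ⇒ NEAR-RESIDUE-FREE** (registered stub `stub_nearResidueFree_of_pinning` of the checked
skeleton of stmt-ABC-14354, line `SketchIdeator1`; proof = the planner's, kernel-checked in the sketch):
split `Φ_t(T) = t(p; D_p) + c₁'·recSumAway (t/c₁') p T` on each family (`recSum_split`); the first term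
is constant on `F` (resp. `F'`), the second has means within `c₁'A` by EH, and the total means are
within `2c₃` (`pinning_means`). [folklore] -/
theorem stub_nearResidueFree_of_pinning {κ A ε c₁ c₁' c₃ : ℝ} (hc₁' : 0 < c₁') (t : Table)
    (hw : InWindow ε c₁ c₁' t) (hB : ∀ a b c : ℕ, IsBalanced κ a b c → |(recSum t a b c : ℝ)| ≤ c₃)
    (hE : PinningFamilies κ A) : NearResidueFree κ (2 * c₃ + c₁' * A) t := by
  intro p i j k r s z r' s' z' hp hocc hocc'
  obtain ⟨F, F', hFne, hF'ne, hF, hF', hW⟩ := hE p i j k r s z r' s' z' hp hocc hocc'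
  set w : RTable := fun q i j k r s z => (t q i j k r s z : ℝ) / c₁' with hw_def
  have hwb : WindowBounded w := by
    intro q i' j' k' r₀ s₀ z₀ hq
    simp only [hw_def]
    rw [abs_div, abs_of_pos hc₁', div_le_iff₀ hc₁']
    calc |(t q i' j' k' r₀ s₀ z₀ : ℝ)| ≤ c₁' * (((i' + j' + k' : ℕ) : ℝ) + 1) * Real.log q :=
        (hw q i' j' k' r₀ s₀ z₀ hq).2
      _ = (((i' + j' + k' : ℕ) : ℝ) + 1) * Real.log q * c₁' := by ring
  have hA := hW w hwb
  set Φ : ℕ × ℕ × ℕ → ℝ := fun T => (recSum t T.1 T.2.1 T.2.2 : ℝ) with hΦ_def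
  have hΦF : ∀ T ∈ F, |Φ T| ≤ c₃ := fun T hT => hB _ _ _ (hF T hT).1
  have hΦF' : ∀ T ∈ F', |Φ T| ≤ c₃ := fun T hT => hB _ _ _ (hF' T hT).1
  have hpin : |mean F Φ - mean F' Φ| ≤ 2 * c₃ := pinning_means F F' hFne hF'ne Φ c₃ hΦF hΦF'
  set g : ℕ × ℕ × ℕ → ℝ := fun T => recSumAway w p T.1 T.2.1 T.2.2 with hg_def
  have hmF : mean F Φ = (t p i j k r s z : ℝ) + c₁' * mean F g := by
    rw [← mean_affine F hFne]
    unfold mean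
    congr 1
    refine Finset.sum_congr rfl fun T hT => ?_
    exact recSum_split hc₁'.ne' t (hF T hT).2.1 (hF T hT).2.2
  have hmF' : mean F' Φ = (t p i j k r' s' z' : ℝ) + c₁' * mean F' g := by
    rw [← mean_affine F' hF'ne]
    unfold mean
    congr 1
    refine Finset.sum_congr rfl fun T hT => ?_
    exact recSum_split hc₁'.ne' t (hF' T hT).2.1 (hF' T hT).2.2
  rw [hmF, hmF'] at hpin
  have e : (t p i j k r s z : ℝ) - (t p i j k r' s' z' : ℝ) =
      ((t p i j k r s z : ℝ) + c₁' * mean F g - ((t p i j k r' s' z' : ℝ) + c₁' * mean F' g)) -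
        c₁' * (mean F g - mean F' g) := by ring
  rw [e]
  calc |((t p i j k r s z : ℝ) + c₁' * mean F g - ((t p i j k r' s' z' : ℝ) + c₁' * mean F' g)) -
        c₁' * (mean F g - mean F' g)|
      ≤ |(t p i j k r s z : ℝ) + c₁' * mean F g - ((t p i j k r' s' z' : ℝ) + c₁' * mean F' g)| +
        |c₁' * (mean F g - mean F' g)| := abs_sub _ _
    _ ≤ 2 * c₃ + c₁' * A := by
        refine add_le_add hpin ?_
        rw [abs_mul, abs_of_pos hc₁']
        exact mul_le_mul_of_nonneg_left hA hc₁'.le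

end Summit.ABC.ABC.Theorems.TameLocalReceptacle
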